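import Summits.QuantumFields.YangMills.Theorems.FemtoTransferGapRungW1upLink
import Literature.MathematicalPhysics.QuantumFieldTheory.LatticeGaugeStaticPotentialProofs
import HarnessLib

/-!
# Definitions for the fixed-lattice rungs of the trace-door cruxes: the flat SHEET configuration, the `x`-Polyakov holonomy through the
# origin, its distance to the centre, and the localised physical trial function

DEFINITIONS ONLY (D-0009: new definitions in `Theorems/` are reviewed; the theorems about them live in the companion proof modules
`…SwapTwistDeficitFlatSheetBox.lean`, `…SwapTwistDeficitPolyakovHolonomy.lean`, `…SwapTwistDeficitSheetTrial.lean`).  They serve the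
FIXED-`L` BC5 rungs («r1 at every fixed lattice size») of K2a `ThermalTraceWindow.SubFemtoFirstLevel` (item stmt-QuantumFields-28291) and of
`SwapTwistDeficit.TwistDeficit` (stmt-QuantumFields-23317), lines g8-B / g10-B of seat ym-idea-4.  On the spatial torus `(ℤ/L)³` with `SU(2)` links:

* `sheetCfg L = twist 0 (diagSU2 (π/2)) 1` — the FLAT lattice connection whose `x`-links issuing from the plane `x₀ = 0` equal `diag(i, −i)` and
  whose other links are `1` (a toron off the centre: `x`-holonomy `diag(i,−i)`, `y`- and `z`-holonomy `1`);
* `lineEdge L j = (j·e₀, 0)`, `polyXAux U n = U(ℓ₀)⋯U(ℓ_{n−1})`, the `x`-POLYAKOV HOLONOMY `polyX U = polyXAux U L` through the origin and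
  `polDist U = vacDist (polyX U)` — its Hilbert–Schmidt distance to the centre `{±1}` (gauge and centre-twist invariant, see the companions);
* the ramps `rampHi t = max 0 (min 1 (4t − 6))` (`= 0` for `t ≤ 3/2`, `= 1` for `t ≥ 7/4`) and `rampLo t = max 0 (min 1 (2 − 4t))` (`= 1` for
  `t ≤ 1/4`, `= 0` for `t ≥ 1/2`), and the TRIAL FUNCTION `sheetTrial U = rampHi (polDist U) · rampLo (polDist (S U))`, `S = configPerm (swap 0 1)`
  the spatial axis swap: a physical zero-flux test function with values in `[0,1]`, equal to `1` near `sheetCfg L`, whose swap `sheetTrial ∘ S`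
  has disjoint (indeed `polDist`-separated) support.

HONEST FRAMING: concrete fixed-lattice objects for finite-dimensional variational witnesses; no renormalisation-group content; nothing here bears
on infinite volume, the continuum limit or the Clay Yang–Mills gap.
References: [cite: Luscher1983, §2] (torons, Polyakov loops and centre twists on the torus); [cite: tHooft1979] (electric flux ∕ twists);
[cite: ReedSimonIV1978, Thm. XIII.1] (min–max, where the trial function is used).
-/

set_option autoImplicit false

noncomputable section

open Real
open Literature.MathematicalPhysics.QuantumFieldTheory
open Literature.MathematicalPhysics.QuantumLattice

namespace Summit.QuantumFields.YangMills.Theorems.FemtoTransferGap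

namespace FlatSheet

variable {L : ℕ}

/-- **The flat sheet configuration** on `(ℤ/L)³`: `twist 0 (diag(i,−i)) 1` — the `x`-links issuing from the plane `x₀ = 0` carry
`diagSU2 (π/2) = diag(i, −i)`, every other link is `1`. [cite: Luscher1983, §2] -/
def sheetCfg (L : ℕ) : GaugeConfig 3 L SU2 := twist 0 (diagSU2 (π / 2)) 1

/-- The `j`-th link of the `x`-axis through the origin: the edge from the site `j·e₀` in direction `0`. [cite: Luscher1983, §2] -/
def lineEdge (L : ℕ) (j : ℕ) : Edge 3 L := (Pi.single 0 ((j : ℕ) : ZMod L), 0)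

/-- Partial holonomy `P_n(U) = U(ℓ₀) U(ℓ₁) ⋯ U(ℓ_{n−1})` along the `x`-axis through the origin. [cite: Luscher1983, §2] -/
def polyXAux (U : GaugeConfig 3 L SU2) : ℕ → SU2
  | 0 => 1
  | n + 1 => polyXAux U n * U (lineEdge L n)

/-- **The `x`-Polyakov holonomy through the origin** `P(U) = U(0;0) U(e₀;0) ⋯ U((L−1)e₀;0) ∈ SU(2)`. [cite: Luscher1983, §2] -/
def polyX (U : GaugeConfig 3 L SU2) : SU2 := polyXAux U L

/-- **Distance of the `x`-holonomy to the centre** `polDist U = min(‖P(U) − 1‖_F, ‖P(U) + 1‖_F) ∈ [0, 2]` (the tree's `vacDist`).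
[cite: Luscher1983, §2] -/
def polDist (U : GaugeConfig 3 L SU2) : ℝ := vacDist (polyX U)

/-- The upper ramp `rampHi t = max 0 (min 1 (4t − 6))`: `0` on `t ≤ 3/2`, `1` on `t ≥ 7/4`, `4`-Lipschitz, values in `[0,1]`. [folklore] -/
def rampHi (t : ℝ) : ℝ := max 0 (min 1 (4 * t - 6))

/-- The lower ramp `rampLo t = max 0 (min 1 (2 − 4t))`: `1` on `t ≤ 1/4`, `0` on `t ≥ 1/2`, `4`-Lipschitz, values in `[0,1]`. [folklore] -/
def rampLo (t : ℝ) : ℝ := max 0 (min 1 (2 - 4 * t))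

/-- **The sheet trial function** `sheetTrial U = rampHi (polDist U) · rampLo (polDist (S U))`, `S = configPerm (swap 0 1)`: a `[0,1]`-valued
physical zero-flux test function localised where the `x`-holonomy is far from the centre and the `y`-holonomy is near it (so `= 1` near
`sheetCfg L`, and `sheetTrial · (sheetTrial ∘ S) = 0`). [cite: ReedSimonIV1978, Thm. XIII.1] -/
def sheetTrial (U : GaugeConfig 3 L SU2) : ℝ :=
  rampHi (polDist U) * rampLo (polDist (configPerm (Equiv.swap (0 : Fin 3) 1) U))

end FlatSheet

end Summit.QuantumFields.YangMills.Theorems.FemtoTransferGap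

end
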